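import Literature.Computability.AlgebraicComplexity.AndrewsForbes2022Applications
import Literature.Computability.AlgebraicComplexity.AndrewsForbes2022Thm38Proofs
import Literature.Computability.AlgebraicComplexity.AndrewsForbes2022Prop35AllFields
import Literature.Computability.AlgebraicComplexity.DeterminantalIdealSFTAllFields
import Literature.Computability.AlgebraicComplexity.FormulaUnfolding

/-!
# Andrews–Forbes 2022, Lemma 7.1 — PROVED (`AndrewsForbes2022_lemma_7_1_holds`)

Discharge of the named fact `AndrewsForbes2022_lemma_7_1` (`AndrewsForbes2022Applications.lean`,
val-lit row AndrewsForbes2022-B): if a monotone `t : ℕ → ℕ` bounds the border formula complexity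
of every bideterminant `(K_σ | K_σ)(X)` from below by `t(σ₁)`, then for `1 ≤ r` and
`2 (s+1) ν² < t(r)` the matrix generator `𝒢_{ν,ν,r-1}(Y, Z) = YZ` (Construction 2.8) hits the
closure of the `ν²`-variate fan-in-two formulas with at most `s` gates over `F((ε))`
[cite: AndrewsForbes2022, Lemma 7.1] (R. Andrews, M. A. Forbes, *Ideals, determinants, and
straightening: proving and using lower bounds for polynomial ideals*, STOC 2022,
arXiv:2112.00792, Lemma 7.1, p. 36).

The proof FOLLOWS THE PRINTED PROOF (p. 36): suppose `f ≠ 0` lies in the closure, i.e. some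
formula `h ∈ F((ε))[X]` with `≤ s` gates has `h = f + O(ε)`, and `f(𝒢_{ν,ν,r-1}) = 0`.
* Lemma 2.10 over every field (tree: `AndrewsForbes2022_lemma_2_10_allFields`, val-lit p2,
  `DeterminantalIdealSFTAllFields.lean`): `f ∈ I^det_{ν,ν,r}`; in particular `r ≤ ν`
  (`Theorem38.detIdeal_eq_bot`).
* Prop. 3.5 over every field (tree: `AndrewsForbes2022_prop_3_5_of_field`, val-lit t24,
  `AndrewsForbes2022Prop35AllFields.lean`): linear forms `ℓ_{i,j}(X, ε)` over `F(ε)`, `α ≠ 0`,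
  `q ∈ ℤ` and a partition `σ` with `σ₁ ≥ r` and parts in `[1, ν]` such that
  `f(ℓ(X, ε)) = α ε^q (K_σ | K_σ)(X) + O(ε^{q+1})`.
* "This yields a formula of size `sn` that computes `(K_σ | K_σ)(X) + O(ε)`": the formula is
  `H = (α ε^q)⁻¹ · h(ℓ(X, ε); ε ↦ ε^{N+1})` where the old `ε` of `h` is first replaced by
  `ε^{N+1}` (`epsPow`, as in the tree's proof of Thm. 3.8; `N = e · deg(h - f) + q⁺` with `ε^{-e}`
  a common bound for the poles of the `ℓ_{i,j}`, so that the error `(h - f)(ℓ)` stays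
  `O(ε^{q+1})`, `PolyOrdGE.bind₁_of_totalDegree_le`).  SIZE, in the tree's gate-count measure of
  `formulaClass` / `borderFormulaComplexity` (fan-in-two gates, weighted sums, free constants),
  by the formula calculus of `FormulaUnfolding.lean`: `ε ↦ ε^{N+1}` is a change of constants
  (`formulaComplexity_map_le`, `≤ s` gates), substituting the `ν²`-term linear forms
  (`≤ ν²` gates each, `formulaComplexity_linearForm_le`) into the `≤ s + 1` leaves costs
  `≤ s + (s+1) ν²` (`formulaComplexity_bind₁_le`), the final scaling one more gate
  (`formulaComplexity_smul_le`); total `≤ s + (s+1)ν² + 1 ≤ 2 (s+1) ν²` as `ν ≥ r ≥ 1` — exactly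
  the constant of the typed statement (whose docstring derives `2ν²(g+1)` in the BCS cost model;
  the tree's weighted-sum gates are cheaper).
* Hence `borderFormulaComplexity (K_σ | K_σ) ≤ 2(s+1)ν² < t(r) ≤ t(σ₁)` (monotonicity of `t`),
  contradicting the hypothesis `t(σ₁) ≤ borderFormulaComplexity (K_σ | K_σ)`.

Honest framing: a discharge of typed literature (net debt −1) — a conditional
hardness-to-randomness lemma, re-proved in the kernel; VP ≠ VNP is NOT proved and nothing here is
progress on it.  (val-lit p3 g3, 2026-08-26.)
-/

noncomputable section

open MvPolynomial Matrix
open scoped RatFunc LaurentSeries Polynomial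

namespace Literature.Computability.AlgebraicComplexity

namespace Lemma71

universe u v

/-- A linear form `∑_{i ∈ s} c_i X_i` has a fan-in-two formula with at most `#s` gates (one
weighted-sum gate per term: `c_a X_a + 1 · (rest)`). [cite: BurgisserClausenShokrollahi1997, §21.1 p. 549] -/
theorem formulaComplexity_linearForm_le {k : Type u} [CommSemiring k] {σ : Type v}
    (s : Finset σ) (c : σ → k) :
    formulaComplexity (∑ i ∈ s, C (c i) * X i) ≤ s.card := by
  classical
  rw [← exists_wexpr_iff_formulaComplexity_le]
  induction s using Finset.induction_on with
  | empty => exact ⟨.const 0, by simp, by simp⟩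
  | insert a s ha ih =>
    obtain ⟨e, he, hs⟩ := ih
    refine ⟨.lin (c a) (.var a) 1 e, ?_, ?_⟩
    · rw [Finset.sum_insert ha, WExpr.eval_lin, he, WExpr.eval_var, one_smul, smul_eq_C_mul]
    · rw [Finset.card_insert_of_notMem ha, WExpr.size_lin, WExpr.size_var]
      omega

end Lemma71

set_option maxHeartbeats 800000 in
open Theorem38 Lemma71 in
/-- **Discharge of `AndrewsForbes2022_lemma_7_1`** (Lemma 7.1, first part, every field), following
the printed proof with the tree's Lemma 2.10 and Prop. 3.5 over all fields; see the module
docstring for the architecture and the size bookkeeping. [cite: AndrewsForbes2022, Lemma 7.1] -/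
theorem AndrewsForbes2022_lemma_7_1_holds : AndrewsForbes2022_lemma_7_1 := by
  intro F _ t ht hyp ν s r hr hsr f hf hf0 hzero
  classical
  obtain ⟨h, hh, hhf⟩ := hf
  change formulaComplexity h ≤ s at hh
  -- Lemma 2.10: `f ∈ I^det_{ν,ν,r}`
  have hdet : f ∈ detIdeal F ν ν r :=
    (AndrewsForbes2022_lemma_2_10_allFields F ν ν r hr f).mp hzero
  -- hence `r ≤ ν`
  by_cases hrν : r ≤ ν
  swap
  · apply hf0
    have := hdet
    rwa [detIdeal_eq_bot (show ¬ (r ≤ ν ∧ r ≤ ν) from fun h' => hrν h'.1), Ideal.mem_bot] at this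
  have hν : 1 ≤ ν := hr.trans hrν
  -- Proposition 3.5 over every field
  obtain ⟨c, q, α, σ, -, hα, hrσ, hσ, h35⟩ :=
    AndrewsForbes2022_prop_3_5_of_field F ν ν r hr f hdet hf0
  have hσ0 : σ ≠ 0 := by
    rintro rfl
    simp only [Multiset.sup_zero, bot_eq_zero', nonpos_iff_eq_zero] at hrσ
    omega
  -- the hypothesis on `t` at the partition `σ`
  have ht1 : t r ≤ borderFormulaComplexity F (kBideterminant F ν ν σ) :=
    (ht hrσ).trans (hyp ν ν σ hσ0 hσ)
  -- it remains to bound the border formula complexity of `(K_σ | K_σ)` by `2 (s+1) ν²`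
  suffices hb : borderFormulaComplexity F (kBideterminant F ν ν σ) ≤ 2 * (s + 1) * (ν * ν) by
    omega
  -- ### the formula `H = (α ε^q)⁻¹ · h(ℓ(X, ε); ε ↦ ε^{N+1})`
  -- notation
  obtain ⟨ι, hι⟩ : ∃ ι : RatFunc F →+* LaurentSeries F,
      ι = algebraMap (RatFunc F) (LaurentSeries F) := ⟨_, rfl⟩
  obtain ⟨fbar, hfbar⟩ : ∃ fbar : MvPolynomial (Fin ν × Fin ν) (LaurentSeries F),
      fbar = MvPolynomial.map (algebraMap F (LaurentSeries F)) f := ⟨_, rfl⟩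
  obtain ⟨Kbar, hKbar⟩ : ∃ Kbar : MvPolynomial (Fin ν × Fin ν) (LaurentSeries F),
      Kbar = MvPolynomial.map (algebraMap F (LaurentSeries F)) (kBideterminant F ν ν σ) := ⟨_, rfl⟩
  obtain ⟨ℓL, hℓL⟩ : ∃ ℓ : Fin ν × Fin ν → MvPolynomial (Fin ν × Fin ν) (LaurentSeries F),
      ℓ = fun ij => ∑ kl, C (ι (c ij kl)) * X kl := ⟨_, rfl⟩
  -- orders of the poles of the linear forms, degree of the error term, the exponent `N`
  obtain ⟨e, he⟩ := IsOrdGE.exists_neg_nat_forall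
    (fun p : (Fin ν × Fin ν) × (Fin ν × Fin ν) => ((c p.1 p.2 : RatFunc F) : LaurentSeries F))
  obtain ⟨Dh, hDh⟩ : ∃ Dh : ℕ, Dh = (h - fbar).totalDegree := ⟨_, rfl⟩
  obtain ⟨N, hN⟩ : ∃ N : ℕ, N = e * Dh + q.toNat := ⟨_, rfl⟩
  obtain ⟨uL, huL⟩ : ∃ uL : LaurentSeries F, uL = HahnSeries.single (-q) α⁻¹ := ⟨_, rfl⟩
  obtain ⟨H, hH⟩ : ∃ H : MvPolynomial (Fin ν × Fin ν) (LaurentSeries F),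
      H = C uL * MvPolynomial.bind₁ ℓL (MvPolynomial.map (epsPow F N) h) := ⟨_, rfl⟩
  -- ### size of `H`
  have hEℓ : ∀ kl, formulaComplexity (ℓL kl) ≤ ν * ν := by
    intro kl
    rw [hℓL]
    refine (formulaComplexity_linearForm_le (Finset.univ : Finset (Fin ν × Fin ν))
      (fun kl' => ι (c kl kl'))).trans ?_
    simp [Finset.card_univ, Fintype.card_prod, Fintype.card_fin]
  have hE1 : formulaComplexity (MvPolynomial.map (epsPow F N) h) ≤ s :=
    (formulaComplexity_map_le _ _).trans hh
  have hE2 : formulaComplexity (MvPolynomial.bind₁ ℓL (MvPolynomial.map (epsPow F N) h)) ≤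
      s + (s + 1) * (ν * ν) :=
    (formulaComplexity_bind₁_le hEℓ _).trans
      (Nat.add_le_add hE1 (Nat.mul_le_mul_right _ (Nat.succ_le_succ hE1)))
  have hE3 : formulaComplexity H ≤ 2 * (s + 1) * (ν * ν) := by
    rw [hH, ← smul_eq_C_mul]
    refine (formulaComplexity_smul_le _ _).trans ?_
    have hνν : 1 ≤ ν * ν := Nat.one_le_iff_ne_zero.mpr (Nat.mul_ne_zero (by omega) (by omega))
    nlinarith [hE2, hνν]
  -- ### `H = (K_σ | K_σ) + O(ε)`
  -- Step 1: the identity of Prop. 3.5 pushed to `F((ε))`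
  obtain ⟨ErrK, hErrK⟩ : ∃ ErrK : MvPolynomial (Fin ν × Fin ν) (RatFunc F),
      ErrK = MvPolynomial.aeval (fun ij : Fin ν × Fin ν =>
        ∑ kl : Fin ν × Fin ν, C (c ij kl) * X kl) f -
      C (RatFunc.X ^ q * algebraMap F (RatFunc F) α) *
        MvPolynomial.map (algebraMap F (RatFunc F)) (kBideterminant F ν ν σ) := ⟨_, rfl⟩
  have hErr : PolyOrdGE (q + 1) (MvPolynomial.map ι ErrK) := by
    intro d
    rw [MvPolynomial.coeff_map, hι]
    have := (isBigOEps_iff_isOrdGE _ _).mp (h35 d)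
    rw [← hErrK] at this
    exact this
  have hιF : ι.comp (algebraMap F (RatFunc F)) = algebraMap F (LaurentSeries F) := by
    rw [hι]; exact algebraMap_ratFunc_comp_algebraMap
  have hfℓ : MvPolynomial.map ι (MvPolynomial.aeval (fun ij : Fin ν × Fin ν =>
      ∑ kl : Fin ν × Fin ν, C (c ij kl) * X kl) f) = MvPolynomial.bind₁ ℓL fbar := by
    have hfun : (fun i : Fin ν × Fin ν => MvPolynomial.map ι
        (∑ kl : Fin ν × Fin ν, C (c i kl) * (X kl : MvPolynomial _ (RatFunc F)))) = ℓL := by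
      rw [hℓL]; funext ij; simp only [map_sum, map_mul, map_C, map_X]
    rw [← MvPolynomial.aeval_map_algebraMap (RatFunc F), MvPolynomial.aeval_eq_bind₁, map_bind₁,
      MvPolynomial.map_map, hιF, hfbar, hfun]
  have hKσ : MvPolynomial.map ι (C (RatFunc.X ^ q * algebraMap F (RatFunc F) α) *
      MvPolynomial.map (algebraMap F (RatFunc F)) (kBideterminant F ν ν σ)) =
      C (HahnSeries.single q α) * Kbar := by
    rw [map_mul, map_C, MvPolynomial.map_map, hιF, hKbar]
    congr 2
    rw [hι, map_mul, show algebraMap (RatFunc F) (LaurentSeries F) (RatFunc.X ^ q) =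
        HahnSeries.single q 1 from coe_ratFunc_X_zpow q,
      show algebraMap (RatFunc F) (LaurentSeries F) (algebraMap F (RatFunc F) α) =
        HahnSeries.C α from coe_ratFunc_algebraMap _, HahnSeries.C_apply,
      HahnSeries.single_mul_single]
    simp
  have hI1 : MvPolynomial.bind₁ ℓL fbar =
      C (HahnSeries.single q α) * Kbar + MvPolynomial.map ι ErrK := by
    rw [← hfℓ, ← hKσ, hErrK, map_sub]; ring
  -- Step 2: the linear forms have poles of order `≤ e`
  have hℓord : ∀ ij, PolyOrdGE (-(e : ℤ)) (ℓL ij) := by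
    intro ij
    rw [hℓL]
    refine PolyOrdGE.sum fun kl _ => ?_
    have hc : IsOrdGE (-(e : ℤ)) (ι (c ij kl)) := by rw [hι]; exact he (ij, kl)
    simpa using (PolyOrdGE.C (σ := Fin ν × Fin ν) hc).mul (PolyOrdGE.X kl)
  -- Step 3: the error `h - f` after `ε ↦ ε^{N+1}` and the substitution
  have hsplit : MvPolynomial.bind₁ ℓL (MvPolynomial.map (epsPow F N) h) =
      MvPolynomial.bind₁ ℓL fbar +
        MvPolynomial.bind₁ ℓL (MvPolynomial.map (epsPow F N) (h - fbar)) := by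
    rw [← map_add, map_sub, hfbar, map_epsPow_map_algebraMap, add_sub_cancel]
  have hE2' : PolyOrdGE (1 + q)
      (MvPolynomial.bind₁ ℓL (MvPolynomial.map (epsPow F N) (h - fbar))) := by
    have h1 : PolyOrdGE (((N : ℤ) + 1) * 1) (MvPolynomial.map (epsPow F N) (h - fbar)) := by
      rw [hfbar]; exact hhf.map_epsPow N
    have hdeg : (MvPolynomial.map (epsPow F N) (h - fbar)).totalDegree ≤ Dh := by
      rw [hDh]; exact totalDegree_map_le' _ _
    have h2 := h1.bind₁_of_totalDegree_le hdeg hℓord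
    refine h2.mono ?_
    have : q ≤ (q.toNat : ℤ) := Int.self_le_toNat q
    rw [hN]; push_cast; nlinarith
  -- Step 4: assemble
  have huq : uL * HahnSeries.single q α = 1 := by
    rw [huL, HahnSeries.single_mul_single, ← HahnSeries.single_zero_one]
    congr 1
    · ring
    · exact inv_mul_cancel₀ hα
  have hkey : H - Kbar = C uL * MvPolynomial.map ι ErrK +
      C uL * MvPolynomial.bind₁ ℓL (MvPolynomial.map (epsPow F N) (h - fbar)) := by
    rw [hH, hsplit, hI1]
    have : C uL * C (HahnSeries.single q α) = (1 : MvPolynomial (Fin ν × Fin ν) (LaurentSeries F)) := by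
      rw [← map_mul, huq, map_one]
    linear_combination Kbar * this
  have hfin : PolyOrdGE 1 (H - Kbar) := by
    rw [hkey]
    have hord : IsOrdGE (-q) uL := by rw [huL]; exact IsOrdGE.single _ _
    refine PolyOrdGE.add ?_ ?_
    · exact ((PolyOrdGE.C hord).mul hErr).mono (by omega)
    · exact ((PolyOrdGE.C hord).mul hE2').mono (by omega)
  -- ### conclusion: `(K_σ | K_σ)` is in the closure of formulas with `≤ 2(s+1)ν²` gates
  have hmem : kBideterminant F ν ν σ ∈
      borderClass F (formulaClass (LaurentSeries F) (Fin ν × Fin ν) (2 * (s + 1) * (ν * ν))) := by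
    refine ⟨H, ?_, ?_⟩
    · exact hE3
    · rw [← hKbar]; exact hfin
  exact Nat.sInf_le hmem

end Literature.Computability.AlgebraicComplexity
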